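import Literature.Probability.FitznerVanDerHofstad2017.Stage1InstST10D10   -- HOME draft typed/p13/Stage1InstST10D10_DRAFT.lean c5f6c5747c724f89 (L5: `cellST10`, `SQr/SbQr`, `chi40`, the Neumann certificates; imports L3 tails + L4 `SplitEdgeRowsD10P40` (`dataN`, `rho40`))
import Literature.Probability.FitznerVanDerHofstad2017.Stage1MonoST10       -- HOME draft typed/p13/Stage1MonoST10_DRAFT.lean (typer g10, PART 2: `Stage1MonotoneInCounts`)
import HarnessLib

/-!
# HOME DRAFT (pub-lace10 typer g10, 2026-08-23; NOT filed — lead RULING D29 (3)) — inventory §2 A7 / LEVELC-TASKS P2.1′, PART 3 (the `d = 10` instance):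
# THE (δ)-INSTANCE VALIDITY CONSUMER AT `(P40, ρ40, χ40, stateRev3)` — every table instance below `dataN` (in particular the TRUE-COUNT table) is dominated

WHAT.  (§1) `cellST10N E s := inpMajQ E P40 ρ40 χ40 stateRev3 s (SQr dataN) (SbQr dataN)` — the typed ST10′ recipe with tails evaluated over ANY table instance
`E`, the tails read at instance N's exact Neumann inverses (`cellST10N dataN = cellST10 dataN` by `rfl`); `cellST10Nmono s` = the comparison target at `dataN`
(`inpMajQmono`: cell 37-I replaced by its C-21 majorant).  (§2) Well-formedness of the (δ) instance: every table value of `dataN` is `≥ 0`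
(`dataN_val_nonneg`, from the landed `CertD10.tabsHi_cast_wf` + the 17 NBW literals).  (§3) The FLOOR at `stateRev3` / `χ40` (landed `stateRev3_std`,
`icLo_nonneg_le_icHi`; `χ40 ≥ 0` decided), the SIDE CONDITIONS AT `dataN` — `Bound[G,{1},3,t] < 1`, `Bound[OpenBubble,1,s] < 1`, the ten brackets `≤ 1`, both
points — DECIDED IN THE KERNEL (12 rows, `decide +kernel`), and `S, S̄ ≥ 1` from L5's Neumann certificates (`SOne.one_le_of_certQ`).  (§4) **THE VALIDITY
CONSUMER**: for EVERY `E` with `E.TabLE dataN 10` (same initial cells, `0 ≤ E.tabs ≤ dataN.tabs` value by value), `(cellST10N E s).Dom (cellST10Nmono s)`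
(`cellST10N_dom_mono`), hence `(cellST10N E s).Dom N` for any literal record `N` dominating `cellST10 dataN s` and the C-21 majorant (`cellST10N_dom_of_dom`; the
Summits-side PART 4 feeds the line-Rev3 literals).  (§5) THE TRUE-COUNT INSTANCE `dataTrue`: `dataN` with its 17 live displayed entries replaced by the TRUE
cardinalities `#sawWordsTo 10 n x` / `#trailWordsTo 10 n x` (every other entry as in the landed `dataHi`), and `dataTrue.TabLE dataN 10` from L4's landed-NBW
ties `card_sawWordsTo_le_sawN` / `card_trailWordsTo_le_bawN` ([MadrasSlade1993] Cor. 5.3.2: `c_n(x) ≤ b_n(x)`).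
WHY (LEVELC-CHAIN §3 (i)).  The Level-C record `ST10N.meanField_full_d10_typedStage1_ST10` displays (S2a′) at the recipe's outputs OVER THE NBW-MAJORANT INSTANCE
`dataN`; what a Level-U proof of [NoBLE17] Assumption 4.3 naturally delivers is the bound at the recipe evaluated on the TRUE counts (or any certified majorant
table below `dataN`).  With this file (+ PART 4) the record can be stated for ANY `E ≤ dataN`, the monotonicity being a theorem and the side conditions kernel facts.
HONEST FRAMING.  Definitions + twelve kernel rows + order bookkeeping; no numeral of record, no literal input table, no new `.Dom` literal instance, no theorem
about percolation in any dimension; Level B stays CONDITIONAL on (S2a), the Level-C drafts on (S2a′); nothing here is a cited fact — `[cite:]` tags are LOCATORS.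
`maxHeartbeats` declaration-scoped on the kernel rows only.
-/

set_option Elab.async false

namespace Literature.Probability.FitznerVanDerHofstad2017
namespace Stage1Cells

open NoGoFrame PX BetaMap
open Literature.Probability.Percolation Literature.Probability.LatticeModels

namespace CertD10.ST10P40

open CertD10.EvalRev3P40 (rho40 dataN sawN bawN card_sawWordsTo_le_sawN card_trailWordsTo_le_bawN)
open Stage1Tails.Rem.ST10 (inpMajQ inpMajQmono)

/-! ## §1 The recipe over any table instance, tails at instance N's Neumann inverses -/

/-- **`cellST10N E s`** — the sixty App.-D inputs computed by the typed ST10′ Stage-1 recipe with closed-form tails at `(P40, ρ40, χ40, stateRev3)` over the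
table instance `E`, the tails read at the exact Neumann inverses OF INSTANCE N (`SQr dataN`, `SbQr dataN`; valid majorants for every `E ≤ dataN`, whose `B`,
`B̄` are entrywise below N's).  At `E := dataN` this is `cellST10 dataN` (`cellST10N_dataN`). [cite: FitznerVanDerHofstad2017, §§4–6; notebook Percolation.nb cell 44 (transcript l.1214–1237)] -/
noncomputable def cellST10N (E : DataQ) (s : Pt) : Inputs := inpMajQ E P40 rho40 chi40 stateRev3 s (SQr dataN) (SbQr dataN)

/-- at instance N the generalised record IS the Level-C record's object. [cite: FitznerVanDerHofstad2017, §§4–6; notebook Percolation.nb cell 44] -/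
theorem cellST10N_dataN (s : Pt) : cellST10N dataN s = cellST10 dataN s := rfl

/-- the comparison target at instance N: `cellST10 dataN s` with the cell-37-I field replaced by its C-21 termwise-monotone majorant.
[cite: FitznerVanDerHofstad2017, notebook Percolation.nb cells 37, 44 (transcript l.1035–1055, 1214–1237)] -/
noncomputable def cellST10Nmono (s : Pt) : Inputs := inpMajQmono dataN P40 rho40 chi40 stateRev3 s (SQr dataN) (SbQr dataN)

/-! ## §2 Well-formedness: every table value of `dataHi` / `dataN` is `≥ 0` -/

/-- every table value of the landed record tables `tabsHi` is `≥ 0` over `ℚ` (from `CertD10.tabsHi_cast_wf`). [cite: FitznerVanDerHofstad2017, notebook Percolation.nb cells 5–12] -/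
theorem tabsHi_val_nonneg (k : TKey) : 0 ≤ CertD10.tabsHi.val 10 k := by
  have h := CertD10.tabsHi_cast_wf.val_nonneg k
  rw [TabsQ.val_cast] at h
  exact_mod_cast h

/-- the N-instance `saw` table is `≥ 0`. [cite: MadrasSlade1993, Cor. 5.3.2 (5.3.3) (reprint PDF p. 148)] -/
theorem sawN_nonneg (j : ℕ) (v : V) : 0 ≤ sawN j v := by
  unfold sawN
  split <;> first | exact CertD10.sawRows_nonneg j v | norm_num

/-- the N-instance `baw` table is `≥ 0`. [cite: MadrasSlade1993, Cor. 5.3.2 (5.3.3) (reprint PDF p. 148)] -/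
theorem bawN_nonneg (j : ℕ) (v : V) : 0 ≤ bawN j v := by
  unfold bawN
  split <;> first | exact CertD10.bawRows_nonneg j v | norm_num

/-- the three walk-count differences of cells 7–8 at `dataN` are `≥ 0` (keys off the displayed set; decided). [cite: FitznerVanDerHofstad2017, §4.1; notebook Percolation.nb cells 7–8] -/
theorem dataN_diff_nonneg :
    0 ≤ dataN.tabs.val 10 .sawIk6 ∧ 0 ≤ dataN.tabs.val 10 .sawIk4 ∧ 0 ≤ dataN.tabs.val 10 .sawTwoi6 := by
  decide +kernel

/-- **every table value of the (δ) instance `dataN` is `≥ 0`.** [cite: FitznerVanDerHofstad2017, notebook Percolation.nb cells 5–12] [cite: MadrasSlade1993, Cor. 5.3.2] -/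
theorem dataN_val_nonneg : ∀ k : TKey, 0 ≤ dataN.tabs.val 10 k
  | .I n l v => tabsHi_val_nonneg (.I n l v)
  | .K n l v => tabsHi_val_nonneg (.K n l v)
  | .saw j v => sawN_nonneg j v
  | .baw j v => bawN_nonneg j v
  | .sawIk6 => dataN_diff_nonneg.1
  | .sawIk4 => dataN_diff_nonneg.2.1
  | .sawTwoi6 => dataN_diff_nonneg.2.2

/-! ## §3 Floor, side conditions and Neumann majorants at instance N -/

/-- the [C-22] hook is `≥ 0` at both points (decided). [cite: FitznerVanDerHofstad2016NoBLE, §5.3.1 (5.36)–(5.38)] -/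
theorem chi40_nonneg : ∀ s, 0 ≤ chi40 s stateRev3 := by
  intro s; cases s <;> decide +kernel

/-- THE FLOOR at `(P40, χ40, stateRev3)` over `dataN` (`d = 10 ≥ 3`; `Γ₁, Γ₂ ≥ 1`, `c_j ≥ 0` — `stateRev3_std`; `boundF3[j,i] ≥ 0` — `icLo_nonneg_le_icHi`; `χ40 ≥ 0`).
[cite: FitznerVanDerHofstad2017, §2.5 and notebook Percolation.nb cell 48] -/
theorem floor_dataN : dataN.Floor P40 chi40 stateRev3 where
  three_le_d := by decide
  Gamma1 := le_trans zero_le_one stateRev3_std.1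
  Gamma2 := le_trans zero_le_one stateRev3_std.2.1
  c := stateRev3_std.2.2.2.2
  ic := fun j => ((icLo_nonneg_le_icHi j).1).trans (icLo_nonneg_le_icHi j).2
  chi := chi40_nonneg

set_option maxHeartbeats 40000000 in
/-- side condition at `dataN`: `Bound[G,{1},3,t] < 1`, both points (decided). [cite: FitznerVanDerHofstad2017, notebook Percolation.nb cell 5] -/
theorem sideN_g13 : ∀ t, dataN.g13Rm P40 rho40 t stateRev3 < 1 := by
  intro t; cases t <;> decide +kernel

set_option maxHeartbeats 40000000 in
/-- side condition at `dataN`: `Bound[OpenBubble,1,s] < 1` (composite), both points (decided). [cite: FitznerVanDerHofstad2017, notebook Percolation.nb cell 12] -/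
theorem sideN_ob1 : ∀ s, dataN.ob1RmST P40 rho40 s stateRev3 < 1 := by
  intro s; cases s <;> decide +kernel

set_option maxHeartbeats 40000000 in
/-- side condition at `dataN`: bracket `pi1Br3a ≤ 1`, both points (decided). [cite: FitznerVanDerHofstad2017, notebook Percolation.nb cell 36] -/
theorem sideN_br3a : ∀ s, dataN.evRmST P40 rho40 chi40 s stateRev3 (Rem.pi1Br3a P40 rho40) ≤ 1 := by
  intro s; cases s <;> decide +kernel

set_option maxHeartbeats 40000000 in
/-- side condition at `dataN`: bracket `pi1Br3b ≤ 1`, both points (decided). [cite: FitznerVanDerHofstad2017, notebook Percolation.nb cell 36] -/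
theorem sideN_br3b : ∀ s, dataN.evRmST P40 rho40 chi40 s stateRev3 (Rem.pi1Br3b P40 rho40) ≤ 1 := by
  intro s; cases s <;> decide +kernel

set_option maxHeartbeats 40000000 in
/-- side condition at `dataN`: bracket `pi1Br4a ≤ 1`, both points (decided). [cite: FitznerVanDerHofstad2017, notebook Percolation.nb cell 36] -/
theorem sideN_br4a : ∀ s, dataN.evRmST P40 rho40 chi40 s stateRev3 (Rem.pi1Br4a P40 rho40) ≤ 1 := by
  intro s; cases s <;> decide +kernel

set_option maxHeartbeats 40000000 in
/-- side condition at `dataN`: bracket `pi1Br4b ≤ 1`, both points (decided). [cite: FitznerVanDerHofstad2017, notebook Percolation.nb cell 36] -/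
theorem sideN_br4b : ∀ s, dataN.evRmST P40 rho40 chi40 s stateRev3 (Rem.pi1Br4b P40 rho40) ≤ 1 := by
  intro s; cases s <;> decide +kernel

set_option maxHeartbeats 40000000 in
/-- side condition at `dataN`: bracket `pi1Br5a ≤ 1`, both points (decided). [cite: FitznerVanDerHofstad2017, notebook Percolation.nb cell 36] -/
theorem sideN_br5a : ∀ s, dataN.evRmST P40 rho40 chi40 s stateRev3 (Rem.pi1Br5a P40 rho40) ≤ 1 := by
  intro s; cases s <;> decide +kernel

set_option maxHeartbeats 40000000 in
/-- side condition at `dataN`: bracket `pi1Br5b ≤ 1`, both points (decided). [cite: FitznerVanDerHofstad2017, notebook Percolation.nb cell 36] -/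
theorem sideN_br5b : ∀ s, dataN.evRmST P40 rho40 chi40 s stateRev3 (Rem.pi1Br5b P40 rho40) ≤ 1 := by
  intro s; cases s <;> decide +kernel

set_option maxHeartbeats 40000000 in
/-- side condition at `dataN`: bracket `PsiAlphaI01brA ≤ 1`, both points (decided). [cite: FitznerVanDerHofstad2017, notebook Percolation.nb cell 37] -/
theorem sideN_brIA : ∀ s, dataN.evRmST P40 rho40 chi40 s stateRev3 (Rem.PsiAlphaI01brA P40 rho40) ≤ 1 := by
  intro s; cases s <;> decide +kernel

set_option maxHeartbeats 40000000 in
/-- side condition at `dataN`: bracket `PsiAlphaI01brB ≤ 1`, both points (decided). [cite: FitznerVanDerHofstad2017, notebook Percolation.nb cell 37] -/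
theorem sideN_brIB : ∀ s, dataN.evRmST P40 rho40 chi40 s stateRev3 (Rem.PsiAlphaI01brB P40 rho40) ≤ 1 := by
  intro s; cases s <;> decide +kernel

set_option maxHeartbeats 40000000 in
/-- side condition at `dataN`: bracket `PsiAlphaII01brA ≤ 1`, both points (decided). [cite: FitznerVanDerHofstad2017, notebook Percolation.nb cell 37] -/
theorem sideN_brIIA : ∀ s, dataN.evRmST P40 rho40 chi40 s stateRev3 (Rem.PsiAlphaII01brA P40 rho40) ≤ 1 := by
  intro s; cases s <;> decide +kernel

set_option maxHeartbeats 40000000 in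
/-- side condition at `dataN`: bracket `PsiAlphaII01brB ≤ 1`, both points (decided). [cite: FitznerVanDerHofstad2017, notebook Percolation.nb cell 37] -/
theorem sideN_brIIB : ∀ s, dataN.evRmST P40 rho40 chi40 s stateRev3 (Rem.PsiAlphaII01brB P40 rho40) ≤ 1 := by
  intro s; cases s <;> decide +kernel

/-- **THE SIDE CONDITIONS of `Stage1MonotoneInCounts` HOLD AT THE (δ) INSTANCE `dataN`** (twelve kernel rows). [cite: FitznerVanDerHofstad2017, notebook Percolation.nb cells 5, 12, 36–37] -/
theorem sideN_dataN : dataN.SideN P40 rho40 chi40 stateRev3 :=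
  ⟨sideN_g13, sideN_ob1, sideN_br3a, sideN_br3b, sideN_br4a, sideN_br4b, sideN_br5a, sideN_br5b, sideN_brIA, sideN_brIB, sideN_brIIA, sideN_brIIB⟩

/-- the hypothesis bundle at `E ≤ dataN`. [cite: FitznerVanDerHofstad2017, notebook Percolation.nb cells 3–44 (transcript l.171–1237)] -/
theorem monoHyp_of_tabLE {E : DataQ} (hE : E.TabLE dataN P40.d) : E.MonoHyp dataN P40 rho40 chi40 stateRev3 :=
  ⟨hE, floor_dataN, sideN_dataN⟩

/-- `dataN ≤ dataN`. [cite: FitznerVanDerHofstad2017, notebook Percolation.nb cells 3–44 (transcript l.171–1237)] -/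
theorem monoHypN : dataN.MonoHyp dataN P40 rho40 chi40 stateRev3 :=
  monoHyp_of_tabLE (DataQ.TabLE.refl_of_nonneg dataN dataN_val_nonneg)

/-- the composite's `B`-ingredient at `dataN` is `≥ 0` entrywise, hence so is `B²`. [cite: FitznerVanDerHofstad2017, notebook Percolation.nb cells 30, 41–43] -/
theorem BB_nonneg (s : Pt) :
    ∀ i j, 0 ≤ ((Stage1Tails.Rem.ST10.ingrQ dataN P40 rho40 chi40 s stateRev3).B *
      (Stage1Tails.Rem.ST10.ingrQ dataN P40 rho40 chi40 s stateRev3).B) i j := by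
  intro i j
  rw [Matrix.mul_apply]
  refine Finset.sum_nonneg fun l _ => mul_nonneg ?_ ?_ <;>
    simp only [Stage1Tails.Rem.ST10.ingrQ, Stage1Tails.Rem.ST10.evMQ, Matrix.of_apply] <;> exact monoHypN.ev_nonneg' s _

/-- the composite's `B̄`-ingredient at `dataN` is `≥ 0` entrywise, hence so is `B̄²`. [cite: FitznerVanDerHofstad2017, notebook Percolation.nb cells 31, 41–43] -/
theorem BbBb_nonneg (s : Pt) :
    ∀ i j, 0 ≤ ((Stage1Tails.Rem.ST10.ingrQ dataN P40 rho40 chi40 s stateRev3).Bb *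
      (Stage1Tails.Rem.ST10.ingrQ dataN P40 rho40 chi40 s stateRev3).Bb) i j := by
  intro i j
  rw [Matrix.mul_apply]
  refine Finset.sum_nonneg fun l _ => mul_nonneg ?_ ?_ <;>
    simp only [Stage1Tails.Rem.ST10.ingrQ, Stage1Tails.Rem.ST10.evMQ, Matrix.of_apply] <;> exact monoHypN.ev_nonneg' s _

/-- **`S, S̄ ≥ 0` and `≥ 1` at instance N**, from L5's kernel Neumann certificates `certSN_* / certSbN_* / SQrN_nonneg_* / SbQrN_nonneg_*`. [cite: FitznerVanDerHofstad2017, notebook Percolation.nb cells 41–43 (transcript l.1132–1202)] -/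
theorem sOne_dataN : ∀ s, DataQ.SOne (SQr dataN) (SbQr dataN) s
  | .i => ⟨SQrN_nonneg_i, DataQ.SOne.one_le_of_certQ (BB_nonneg .i) SQrN_nonneg_i certSN_i,
      SbQrN_nonneg_i, DataQ.SOne.one_le_of_certQ (BbBb_nonneg .i) SbQrN_nonneg_i certSbN_i⟩
  | .o => ⟨SQrN_nonneg_o, DataQ.SOne.one_le_of_certQ (BB_nonneg .o) SQrN_nonneg_o certSN_o,
      SbQrN_nonneg_o, DataQ.SOne.one_le_of_certQ (BbBb_nonneg .o) SbQrN_nonneg_o certSbN_o⟩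

/-! ## §4 THE VALIDITY CONSUMER at `d = 10` -/

/-- **THE (δ)-INSTANCE VALIDITY CONSUMER (inventory §2 A7) AT `d = 10`**: for EVERY table instance `E` below `dataN` (same initial cells, `0 ≤ E ≤ dataN` value by value),
the typed ST10′ recipe's outputs at `E` are dominated, in the information order, by the outputs at `dataN` (cell 37-I against its C-21 majorant).
[cite: FitznerVanDerHofstad2016NoBLE, App. D pp. 1110–1117; Assumption 4.3 pp. 1086–1088] [cite: FitznerVanDerHofstad2017, §§4–6] -/
theorem cellST10N_dom_mono (E : DataQ) (hE : E.TabLE dataN P40.d) (s : Pt) : (cellST10N E s).Dom (cellST10Nmono s) :=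
  Stage1Tails.Rem.ST10.inpMajQ_mono_tabs (monoHyp_of_tabLE hE) s (sOne_dataN s)

/-- … hence dominated by any literal record `N` that dominates `cellST10 dataN s` and whose cell-37-I entry dominates the C-21 majorant at `dataN` (the Summits-side
PART 4 supplies the line-Rev3 literals `inputs{I,O}Rev3`). [cite: FitznerVanDerHofstad2016NoBLE, App. D pp. 1110–1117; Assumption 4.3 pp. 1086–1088] -/
theorem cellST10N_dom_of_dom (E : DataQ) (hE : E.TabLE dataN P40.d) (s : Pt) {N : Inputs} (h : (cellST10 dataN s).Dom N)
    (h37 : ((dataN.psiAlphaI01MonoRmST P40 rho40 chi40 s stateRev3 : ℚ) : ℝ) ≤ N.psiAlphaIZeroMinusOneAroundEi) : (cellST10N E s).Dom N :=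
  Stage1Tails.Rem.ST10.inpMajQ_dom_of_le (monoHyp_of_tabLE hE) s (sOne_dataN s) h h37

/-! ## §5 The TRUE-COUNT instance -/

/-- TRUE-COUNT `saw` table: `sawN` with its 8 live displayed NBW majorants replaced by the TRUE self-avoiding-walk counts `c_n(x; 10) = #sawWordsTo 10 n x`.
[cite: MadrasSlade1993, §1.2 (c_n(x)) and Cor. 5.3.2] -/
noncomputable def sawTrue (j : ℕ) (v : V) : ℚ :=
  match j, v with
  | 15, .v1 => (sawWordsTo 10 15 (siteOfList [1] 10)).card | 17, .v1 => (sawWordsTo 10 17 (siteOfList [1] 10)).card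
  | 19, .v1 => (sawWordsTo 10 19 (siteOfList [1] 10)).card | 14, .v2 => (sawWordsTo 10 14 (siteOfList [1, 1] 10)).card
  | 16, .v2 => (sawWordsTo 10 16 (siteOfList [1, 1] 10)).card | 18, .v2 => (sawWordsTo 10 18 (siteOfList [1, 1] 10)).card
  | 16, .v01 => (sawWordsTo 10 16 (siteOfList [2] 10)).card | 18, .v01 => (sawWordsTo 10 18 (siteOfList [2] 10)).card
  | j, v => CertD10.dataHi.tabs.saw j v

/-- TRUE-COUNT `baw` table: `bawN` with its 9 live displayed NBW majorants replaced by the TRUE bond-animal-walk (trail) counts `#trailWordsTo 10 n x`.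
[cite: MadrasSlade1993, §1.2 and Cor. 5.3.2] -/
noncomputable def bawTrue (j : ℕ) (v : V) : ℚ :=
  match j, v with
  | 14, .v0 => (trailWordsTo 10 14 (siteOfList [] 10)).card | 16, .v0 => (trailWordsTo 10 16 (siteOfList [] 10)).card
  | 18, .v0 => (trailWordsTo 10 18 (siteOfList [] 10)).card | 13, .v1 => (trailWordsTo 10 13 (siteOfList [1] 10)).card
  | 15, .v1 => (trailWordsTo 10 15 (siteOfList [1] 10)).card | 17, .v1 => (trailWordsTo 10 17 (siteOfList [1] 10)).card
  | 14, .v2 => (trailWordsTo 10 14 (siteOfList [1, 1] 10)).card | 16, .v2 => (trailWordsTo 10 16 (siteOfList [1, 1] 10)).card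
  | 18, .v2 => (trailWordsTo 10 18 (siteOfList [1, 1] 10)).card
  | j, v => CertD10.dataHi.tabs.baw j v

/-- **the TRUE-COUNT instance `dataTrue`**: the landed record tables `dataHi` with the 17 live displayed count entries replaced by the TRUE cardinalities (every other
entry — the certified `I`/`K` boxes and the kernel-linked counts — unchanged). [cite: MadrasSlade1993, §1.2 and Cor. 5.3.2] [cite: FitznerVanDerHofstad2017, notebook Percolation.nb cells 5–12] -/
noncomputable def dataTrue : DataQ :=
  { CertD10.dataHi with tabs := { CertD10.dataHi.tabs with saw := sawTrue, baw := bawTrue } }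

/-- the true SAW counts are below the N-instance entries everywhere (`c_n(x) ≤ b_n(x)` at the 8 live keys, equal elsewhere). [cite: MadrasSlade1993, Cor. 5.3.2 (5.3.3) (reprint PDF p. 148)] -/
theorem sawTrue_le_sawN (j : ℕ) (v : V) : sawTrue j v ≤ sawN j v := by
  have h := card_sawWordsTo_le_sawN
  unfold sawTrue
  split
  · exact h.1
  · exact h.2.1
  · exact h.2.2.1
  · exact h.2.2.2.1
  · exact h.2.2.2.2.1
  · exact h.2.2.2.2.2.1
  · exact h.2.2.2.2.2.2.1
  · exact h.2.2.2.2.2.2.2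
  · clear h
    unfold sawN
    split <;> first | exact le_rfl | (exfalso; simp_all)

/-- the true trail counts are below the N-instance entries everywhere. [cite: MadrasSlade1993, Cor. 5.3.2 (5.3.3) (reprint PDF p. 148)] -/
theorem bawTrue_le_bawN (j : ℕ) (v : V) : bawTrue j v ≤ bawN j v := by
  have h := card_trailWordsTo_le_bawN
  unfold bawTrue
  split
  · exact h.1
  · exact h.2.1
  · exact h.2.2.1
  · exact h.2.2.2.1
  · exact h.2.2.2.2.1
  · exact h.2.2.2.2.2.1
  · exact h.2.2.2.2.2.2.1
  · exact h.2.2.2.2.2.2.2.1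
  · exact h.2.2.2.2.2.2.2.2
  · clear h
    unfold bawN
    split <;> first | exact le_rfl | (exfalso; simp_all)

/-- the true SAW counts are `≥ 0`. [cite: MadrasSlade1993, Cor. 5.3.2 (5.3.3) (reprint PDF p. 148)] -/
theorem sawTrue_nonneg (j : ℕ) (v : V) : 0 ≤ sawTrue j v := by
  unfold sawTrue
  split <;> first | exact Nat.cast_nonneg _ | exact CertD10.sawRows_nonneg j v

/-- the true trail counts are `≥ 0`. [cite: MadrasSlade1993, Cor. 5.3.2 (5.3.3) (reprint PDF p. 148)] -/
theorem bawTrue_nonneg (j : ℕ) (v : V) : 0 ≤ bawTrue j v := by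
  unfold bawTrue
  split <;> first | exact Nat.cast_nonneg _ | exact CertD10.bawRows_nonneg j v

/-- the three walk-count differences of cells 7–8 at `dataTrue` are those of `dataHi` (keys off the displayed set) and `≥ 0`. [cite: FitznerVanDerHofstad2017, §4.1; notebook Percolation.nb cells 7–8] -/
theorem dataTrue_diff_nonneg :
    0 ≤ dataTrue.tabs.val 10 .sawIk6 ∧ 0 ≤ dataTrue.tabs.val 10 .sawIk4 ∧ 0 ≤ dataTrue.tabs.val 10 .sawTwoi6 :=
  ⟨tabsHi_val_nonneg .sawIk6, tabsHi_val_nonneg .sawIk4, tabsHi_val_nonneg .sawTwoi6⟩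

/-- **`dataTrue ≤ dataN`**: the TRUE-COUNT instance is below the (δ) instance value by value, with the same initial cells, and is well formed.
[cite: MadrasSlade1993, Cor. 5.3.2 (5.3.3) (reprint PDF p. 148)] -/
theorem dataTrue_tabLE : dataTrue.TabLE dataN P40.d where
  ic := rfl
  le k := match k with
    | .I _ _ _ => le_rfl
    | .K _ _ _ => le_rfl
    | .saw j v => sawTrue_le_sawN j v
    | .baw j v => bawTrue_le_bawN j v
    | .sawIk6 => sub_le_sub_right (sawTrue_le_sawN 6 .v2) _
    | .sawIk4 => sub_le_sub_right (sawTrue_le_sawN 4 .v2) _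
    | .sawTwoi6 => sub_le_sub_right (sawTrue_le_sawN 6 .v01) _
  nonneg k := match k with
    | .I n l v => tabsHi_val_nonneg (.I n l v)
    | .K n l v => tabsHi_val_nonneg (.K n l v)
    | .saw j v => sawTrue_nonneg j v
    | .baw j v => bawTrue_nonneg j v
    | .sawIk6 => dataTrue_diff_nonneg.1
    | .sawIk4 => dataTrue_diff_nonneg.2.1
    | .sawTwoi6 => dataTrue_diff_nonneg.2.2

/-- **the recipe at the TRUE counts is dominated by the recipe at the (δ) instance** (cell 37-I against its C-21 majorant). [cite: FitznerVanDerHofstad2016NoBLE, App. D pp. 1110–1117] [cite: MadrasSlade1993, Cor. 5.3.2] -/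
theorem cellST10N_dataTrue_dom_mono (s : Pt) : (cellST10N dataTrue s).Dom (cellST10Nmono s) :=
  cellST10N_dom_mono dataTrue dataTrue_tabLE s

end CertD10.ST10P40

end Stage1Cells
end Literature.Probability.FitznerVanDerHofstad2017
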